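import Mathlib
import Literature.NumberTheory.Automorphic.FuchsianMaassCuspForms
import Literature.NumberTheory.Automorphic.SpectralResolutionSmallSpectrum

/-!
# The cuspidal half of the spectral resolution of a finite volume Fuchsian group: finitely many small cusp forms and Parseval on `𝓒`
(Iwaniec, *Spectral Methods of Automorphic Forms*, GSM 53, Thm 4.7 (4.15) ("any `f ∈ 𝓒(Γ\ℍ)` has
the expansion `f = Σ ⟨f, u_j⟩ u_j`"), §7.3 (the discrete spectrum, "Combining Theorems 4.7 and 7.3
…"), §11.2–11.3 (the exceptional eigenvalues `0 < λ_j < 1/4` are finite in number); PDF pp. 52, 75,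
118–120)

Fourth file of the general-`Γ` assembly of `Literature.NumberTheory.Automorphic.Iwaniec2002_eq_12_5`
(`SpectralTestFunctions` → `SpectralResolution` → `SpectralResolutionSmallSpectrum`): the part of the
hypothesis schema `SpectralResolution Γ F` that the tree ALREADY proves for a general finite volume
group — the cusp forms. From the Hilbert basis of Maass cusp forms of the cuspidal subspace
`𝓒 ⊆ L²(F)` (`Fuchsian.exists_hilbertBasis_maassCuspForms`, Theorem 4.7 for a general group with a
complete system of inequivalent cusps) we extract exactly the discrete-cuspidal fields of
`SpectralResolution`: a countable family `u_x` of Maass cusp forms — automorphic, `C²`,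
`(Δ + λ_x)u_x = 0` with `λ_x ∈ ℝ`, cuspidal at every cusp, orthonormal on `F` — with
**only finitely many `λ_x < 1/4`** and **Parseval on `𝓒`**: `Σ_x |∫_F ū_x f dμ|² = ‖P_𝓒[f]‖²` for every
`f ∈ L²(F)` (`Fuchsian.CuspidalResolution`, `Fuchsian.nonempty_cuspidalResolution`,
`Fuchsian.cuspidalResolution`). What the Eisenstein series files must add to obtain
`SpectralResolution Γ F` is thus the residual spectrum and Theorem 7.3 on the Eisenstein subspace
`𝓔₀ = (𝓒 ⊔ span{residues})ᗮ`; §4 records that remaining input as the data `Fuchsian.SpectralParts`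
and PROVES the assembly `SpectralParts.toResolution : SpectralResolution Γ F` (Pythagoras in
`L²(F) = 𝓒 ⊕ span{ρ_l} ⊕ 𝓔₀`), whence (12.5) and Theorem 12.1 for `Γ` follow from `SpectralParts`
alone (`SpectralResolutionSmallSpectrum.Iwaniec2002_eq_12_5_of_spectralResolution`). Everything is
PROVED; nothing is vendored; no fact is introduced.

1. (§1) **Orthonormal eigenvectors of a compact operator with eigenvalues bounded away from zero
   are finite in number** (`finite_of_isCompactOperator_of_orthonormal_eigenvectors`; F. Riesz): the
   images `T e_i = μ_i e_i` are pairwise at distance `≥ m` and lie in the compact closure of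
   `T(B̄(0,1))`, which has no infinite `m`-separated sequence.
2. (§2) the non-negative Lipschitz test kernel `k₀ = stKernel 1 0` of positive mass (`stLipKernel`):
   `h₀(0) = ∫ g₀ > 0` and `|h₀(t)| ≥ h₀(0)` at the spectral parameters `t = ±i√(1/4 - λ)` of the
   eigenvalues `λ < 1/4` (`selbergTransform_I_mul_re_lt` of `SpectralResolutionSmallSpectrum`).
3. (§3) `CuspidalResolution` (data) and **`nonempty_cuspidalResolution`** (finitely many small cusp
   forms: 1 applied to `T_{k₀}|_𝓒`, compact by `FuchsianCuspFormsCompact`; Parseval on `𝓒`: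
   `HilbertBasis.hasSum_inner_mul_inner`; the classes of the `u_x` lie in `𝓒`).
4. (§4) `eisSubspaceOf 𝓒 R = (𝓒 ⊔ span R)ᗮ`, the data `SpectralParts` (residual orthonormal classes
   `ρ_l ∈ 𝓒ᗮ` with automorphic `C²` eigenfunction representatives, eigenpackets `E_𝔞`, `L²`
   Eisenstein coefficients of test functions, and (7.15) on `𝓔₀`:
   `(1/4π)Σ_𝔞∫|⟨E_𝔞(·,r),f⟩|² dr = ‖P_{𝓔₀}[f]‖²`), `norm_sq_eq_three_parts` (Pythagoras) and
   **`SpectralParts.toResolution`** / `nonempty_spectralResolution_of_parts`.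

## References
* [Iwaniec2002] H. Iwaniec, *Spectral Methods of Automorphic Forms*, 2nd ed., GSM 53, AMS 2002,
  Thm 4.7 (4.15), PDF p. 52; §7.3, PDF p. 75; §11.2–11.3, PDF pp. 118–120
  (held copy `book:iwaniec2002-spectral-methods-automorphic-forms`).
* F. Riesz, B. Sz.-Nagy, *Functional Analysis* (1955), §77–78 (eigenvalues of compact operators).

Mathlib: `IsCompactOperator.isCompact_closure_image_closedBall`, `IsCompact.tendsto_subseq`,
`Infinite.natEmbedding`, `norm_sub_sq`, `HilbertBasis.hasSum_inner_mul_inner`,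
`Submodule.inner_orthogonalProjectionOnto_eq_of_mem_left`, `Submodule.norm_sq_eq_add_norm_sq_projection`,
`Submodule.eq_starProjection_of_mem_orthogonal'`, `Submodule.inf_orthogonal`, `Orthonormal.inner_sum`,
`Orthonormal.inner_right_fintype`, `HasSum.sum`. Literature: `Fuchsian.exists_hilbertBasis_maassCuspForms`,
`Fuchsian.IsMaassCuspForm`, `Fuchsian.cuspFamily`, `Fuchsian.isCompactOperator_cuspFamily`, `LipKernel`
(`FuchsianMaassCuspForms`, `MaassCuspForms`); `stKernel`, `isTestKernel_stKernel`, `exists_lipschitzWith_stKernel`,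
`stKernel_nonneg` (`MaassCuspForms`); `cutMass_pos` (`ModularPartitionOfUnity`); `selbergTransform_I_mul_re_lt`,
`selbergTransform_I_mul_eq_integral` (`SpectralResolutionSmallSpectrum`); `selbergG_nonneg`, `selbergTransform_neg`;
`inner_coe_toLp_eq` (`ModularPretraceFromParseval`).
-/

noncomputable section

open MeasureTheory Set Filter Real UpperHalfPlane
open scoped Topology MatrixGroups ComplexConjugate NNReal ENNReal Pointwise InnerProductSpace

namespace Literature.NumberTheory.Automorphic

/-! ## 1. Orthonormal eigenvectors of a compact operator with eigenvalues bounded away from zero -/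

section CompactFinite

variable {E : Type*} [NormedAddCommGroup E] [InnerProductSpace ℂ E]

/-- **Orthonormal eigenvectors of a compact operator whose eigenvalues are bounded away from zero
are finite in number** (F. Riesz): if `T` is compact, `(e_i)` orthonormal with `T e_i = μ_i e_i` and
`|μ_i| ≥ m > 0`, then the index set is finite — `‖T e_i - T e_j‖² = |μ_i|² + |μ_j|² ≥ 2m²` for
`i ≠ j`, while the `T e_i` lie in the compact set `closure T(B̄(0,1))`. [folklore] -/
theorem finite_of_isCompactOperator_of_orthonormal_eigenvectors {T : E →L[ℂ] E} (hT : IsCompactOperator T)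
    {ι : Type*} {e : ι → E} (he : Orthonormal ℂ e) {μ : ι → ℂ} (heig : ∀ i, T (e i) = μ i • e i)
    {m : ℝ} (hm : 0 < m) (hμ : ∀ i, m ≤ ‖μ i‖) : Finite ι := by
  -- pairwise distances of the `T e_i`
  have hdist : ∀ i j, i ≠ j → m ≤ ‖T (e i) - T (e j)‖ := by
    intro i j hij
    rw [heig, heig]
    have hsq : ‖μ i • e i - μ j • e j‖ ^ 2 = ‖μ i‖ ^ 2 + ‖μ j‖ ^ 2 := by
      rw [@norm_sub_sq ℂ, inner_smul_left, inner_smul_right, he.2 hij, norm_smul, norm_smul, he.1, he.1]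
      simp
    have h1 : m ^ 2 ≤ ‖μ i • e i - μ j • e j‖ ^ 2 := by
      rw [hsq]
      nlinarith [hμ i, hμ j, norm_nonneg (μ i), norm_nonneg (μ j)]
    exact (pow_le_pow_iff_left₀ hm.le (norm_nonneg _) two_ne_zero).mp h1
  by_contra hinf
  rw [not_finite_iff_infinite] at hinf
  set φ : ℕ ↪ ι := Infinite.natEmbedding ι with hφ
  set x : ℕ → E := fun n => T (e (φ n)) with hx
  have hK : IsCompact (closure ((T : E →ₗ[ℂ] E) '' Metric.closedBall 0 1)) :=
    hT.isCompact_closure_image_closedBall 1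
  have hxK : ∀ n, x n ∈ closure ((T : E →ₗ[ℂ] E) '' Metric.closedBall 0 1) := fun n =>
    subset_closure ⟨e (φ n), by simp [Metric.mem_closedBall, he.1], rfl⟩
  obtain ⟨a, -, ψ, hψ, hlim⟩ := hK.tendsto_subseq hxK
  obtain ⟨N, hN⟩ := (Metric.tendsto_atTop.mp hlim) (m / 3) (by positivity)
  have h1 := hN N le_rfl
  have h2 := hN (N + 1) (Nat.le_succ N)
  have hne : φ (ψ N) ≠ φ (ψ (N + 1)) := fun h => (hψ (Nat.lt_succ_self N)).ne (φ.injective h)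
  have hd := hdist _ _ hne
  have hlt : dist (x (ψ N)) (x (ψ (N + 1))) < m := by
    calc dist (x (ψ N)) (x (ψ (N + 1))) ≤ dist (x (ψ N)) a + dist a (x (ψ (N + 1))) := dist_triangle _ _ _
      _ < m / 3 + m / 3 := add_lt_add h1 (by rw [dist_comm]; exact h2)
      _ < m := by linarith
  rw [dist_eq_norm] at hlt
  exact absurd (hd.trans_lt hlt) (lt_irrefl _)

end CompactFinite

/-! ## 2. A non-negative Lipschitz test kernel of positive mass -/

section Kernel

/-- The Lipschitz test kernel `k₀ = stKernel 1 0` (smooth, `0 ≤ k₀ ≤ 1`, `k₀(0) = 1`, supported in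
`[0, 1]`), as a member of the index set `LipKernel` of the commuting family `{T_k|_𝓒}`. [folklore] -/
def stLipKernel : LipKernel := ⟨stKernel 1 0, isTestKernel_stKernel one_pos le_rfl, exists_lipschitzWith_stKernel one_pos 0⟩

/-- Its kernel function. [folklore] -/
theorem stLipKernel_fn : stLipKernel.fn = stKernel 1 0 := rfl

/-- `k₀` has positive mass. [folklore] -/
theorem integral_stKernel_one_zero_pos : 0 < ∫ u in Ioi 0, stKernel 1 0 u := by
  have h := cutMass_pos one_pos
  unfold cutMass cutKernel at h
  have hπ : 0 < 4 * π := by positivity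
  by_contra hle
  push Not at hle
  have : 4 * π * ∫ u in Ioi 0, stKernel 1 0 u ≤ 0 := mul_nonpos_of_nonneg_of_nonpos hπ.le hle
  linarith

/-- `h₀(0) = ∫ g₀ > 0` for `k₀`. [folklore] -/
theorem selbergTransform_zero_re_pos {k : ℝ → ℝ} (hk : IsTestKernel k) (hk0 : ∀ u, 0 ≤ k u)
    (hkpos : 0 < ∫ u in Ioi 0, k u) : 0 < (selbergTransform k (Complex.I * (0 : ℝ))).re := by
  rw [selbergTransform_I_mul_eq_integral hk, Complex.ofReal_re]
  simp only [zero_mul, Real.cosh_zero, one_mul]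
  have hg0 : ∀ r, 0 ≤ selbergG k r := selbergG_nonneg hk0
  have hint0 : 0 ≤ ∫ r, selbergG k r := integral_nonneg (μ := volume) (f := selbergG k) fun r => hg0 r
  rcases hint0.lt_or_eq with hpos | hzero
  · exact hpos
  · exfalso
    have hae : selbergG k =ᵐ[volume] 0 :=
      (integral_eq_zero_iff_of_nonneg (fun r => hg0 r) (integrable_selbergG hk)).mp hzero.symm
    have := integral_eq_zero_of_selbergG_ae_eq_zero hk hae
    linarith

/-- **The transform of a non-negative kernel of positive mass is bounded below at the small spectrum**:
if `1/4 + t² = λ ∈ ℝ` with `λ < 1/4` then `t = ±i√(1/4 - λ)` and `|h(t)| > h(0) > 0`. [folklore] -/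
theorem re_zero_lt_norm_selbergTransform_of_small {k : ℝ → ℝ} (hk : IsTestKernel k) (hk0 : ∀ u, 0 ≤ k u)
    (hkpos : 0 < ∫ u in Ioi 0, k u) {t : ℂ} {l : ℝ} (hl : l < 1 / 4) (ht : (1 / 4 : ℂ) + t ^ 2 = l) :
    (selbergTransform k (Complex.I * (0 : ℝ))).re < ‖selbergTransform k t‖ := by
  set θ : ℝ := Real.sqrt (1 / 4 - l) with hθ
  have hθpos : 0 < θ := Real.sqrt_pos.mpr (by linarith)
  have hθsq : (θ : ℂ) ^ 2 = ((1 / 4 - l : ℝ) : ℂ) := by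
    rw [← Complex.ofReal_pow, Real.sq_sqrt (by linarith)]
  -- `t = ±iθ`
  have hprod : (t - Complex.I * θ) * (t + Complex.I * θ) = 0 := by
    have e : (t - Complex.I * θ) * (t + Complex.I * θ) = t ^ 2 + (θ : ℂ) ^ 2 := by
      ring_nf; rw [Complex.I_sq]; ring
    rw [e, hθsq]
    push_cast
    linear_combination ht
  have hmono := selbergTransform_I_mul_re_lt hk hk0 hkpos (θ₁ := 0) (θ₂ := θ) (by rw [abs_zero, abs_of_pos hθpos]; exact hθpos)
  have hre : (selbergTransform k (Complex.I * θ)).re ≤ ‖selbergTransform k (Complex.I * θ)‖ := Complex.re_le_norm _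
  rcases mul_eq_zero.mp hprod with h | h
  · have ht' : t = Complex.I * θ := sub_eq_zero.mp h
    rw [ht']
    exact hmono.trans_le hre
  · have ht' : t = -(Complex.I * θ) := eq_neg_of_add_eq_zero_left h
    rw [ht', selbergTransform_neg]
    exact hmono.trans_le hre

end Kernel

/-! ## 3. The cuspidal half of the spectral resolution -/

namespace Fuchsian

variable {Γ : Subgroup (GL (Fin 2) ℝ)} {F : Set ℍ} {h : ℕ} {𝔞 : Fin h → OnePoint ℝ} {σ : Fin h → SL(2, ℝ)}
variable (hΓ : Γ ≤ (Matrix.SpecialLinearGroup.toGL : SL(2, ℝ) →* GL (Fin 2) ℝ).range)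
  (hneg : (-1 : GL (Fin 2) ℝ) ∈ Γ) (hd : IsDiscreteSubgroup Γ) (hF : IsHypFundamentalDomain Γ F)
  (hvol : volume F < ⊤)
  (hinfty : ∀ i, (Matrix.SpecialLinearGroup.toGL (σ i) : GL (Fin 2) ℝ) • (OnePoint.infty : OnePoint ℝ) = 𝔞 i)
  (hper : ∀ i, (ConjAct.toConjAct (Matrix.SpecialLinearGroup.toGL (σ i) : GL (Fin 2) ℝ)⁻¹ • Γ).strictPeriods =
    AddSubgroup.zmultiples 1)
  (hineq : ∀ i j, ∀ γ ∈ Γ, γ • 𝔞 i = 𝔞 j → i = j)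
  (hcomplete : ∀ c : OnePoint ℝ, IsCusp c Γ → ∃ i, ∃ γ ∈ Γ, γ • 𝔞 i = c)

/-- **The cuspidal half of `SpectralResolution Γ F`** (Theorem 4.7 in resolution form; data): a
countable family `u_x` of Maass cusp forms of `Γ` — automorphic, `C²`, `(Δ + λ_x)u_x = 0` with
`λ_x ∈ ℝ`, vanishing zero-th Fourier coefficient at every cusp `σ_i∞`, square-integrable and
orthonormal on `F` — with only finitely many `λ_x < 1/4`, such that Parseval holds on the cuspidal
subspace: `Σ_x |∫_F ū_x f dμ|² = ‖P_𝓒[f]‖²` for every `f ∈ L²(F)`, `P_𝓒` the orthogonal projection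
onto `Fuchsian.cuspSubmodule` ("any `f ∈ 𝓒(Γ\ℍ)` has the expansion (4.15)").
[cite: Iwaniec2002, Thm 4.7 (4.15), PDF p. 52; §7.3, PDF p. 75] -/
structure CuspidalResolution (hΓ : Γ ≤ (Matrix.SpecialLinearGroup.toGL : SL(2, ℝ) →* GL (Fin 2) ℝ).range)
    (hneg : (-1 : GL (Fin 2) ℝ) ∈ Γ) (hd : IsDiscreteSubgroup Γ) (hF : IsHypFundamentalDomain Γ F)
    (σ : Fin h → SL(2, ℝ)) where
  /-- index set of the Maass cusp forms -/
  ι : Type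
  countable_ι : Countable ι
  /-- the eigenvalues `λ_x` -/
  lam : ι → ℝ
  /-- the Maass cusp forms `u_x` -/
  u : ι → ℍ → ℂ
  automorphic_u : ∀ x, IsAutomorphic Γ (u x)
  isC2_u : ∀ x, IsC2 (u x)
  eigen_u : ∀ x z, hypLaplacian (u x) z + (lam x : ℂ) * u x z = 0
  cuspidal_u : ∀ x i z, cuspMeanAt (σ i) (u x) z = 0
  /-- the classes of the `u_x` lie in the cuspidal subspace `𝓒 ⊆ L²(F)` -/
  toLp_mem_cusp : ∀ x (hx : MemLp (u x) 2 ((volume : Measure ℍ).restrict F)), hx.toLp (u x) ∈ cuspSubmodule hΓ hneg hd hF σ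
  sqIntegrable_u : ∀ x, IntegrableOn (fun z => ‖u x z‖ ^ 2) F
  norm_u : ∀ x, ∫ z in F, u x z * conj (u x z) = 1
  orthogonal_u : ∀ x y, x ≠ y → ∫ z in F, u x z * conj (u y z) = 0
  finite_small : {x | lam x < 1 / 4}.Finite
  /-- Parseval on `𝓒`: `Σ_x |⟨u_x, f⟩|² = ‖P_𝓒 [f]‖²` -/
  parseval_cusp : ∀ (f : ℍ → ℂ) (hf : MemLp f 2 ((volume : Measure ℍ).restrict F)),
    HasSum (fun x => ‖∫ z in F, conj (u x z) * f z‖ ^ 2)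
      (‖(cuspSubmodule hΓ hneg hd hF σ).orthogonalProjectionOnto (hf.toLp f)‖ ^ 2)

include hvol hinfty hper hineq hcomplete in
/-- **Existence of the cuspidal resolution** for a finite volume group with a complete system of
inequivalent cusps (width-one scaling matrices `σ_i`): from the Hilbert basis of Maass cusp forms of
`𝓒` (`exists_hilbertBasis_maassCuspForms`); **only finitely many `λ_x < 1/4`** by Riesz (§1) for the
compact `T_{k₀}|_𝓒` (`|h₀(t_x)| > h₀(0) > 0` at the small spectrum); Parseval on `𝓒` by
`HilbertBasis.hasSum_inner_mul_inner`. [cite: Iwaniec2002, Thm 4.7 (4.15), PDF p. 52; §7.3, PDF p. 75; §11.2, PDF p. 118] -/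
theorem nonempty_cuspidalResolution : Nonempty (CuspidalResolution hΓ hneg hd hF σ) := by
  classical
  obtain ⟨s, b, hs, hb, hmem⟩ := exists_hilbertBasis_maassCuspForms hΓ hneg hd hF hvol hinfty hper hineq hcomplete
  haveI : Countable s := hs.to_subtype
  set μF := (volume : Measure ℍ).restrict F with hμF
  -- the Maass cusp forms representing the basis vectors
  choose U T hUT hUx hUeig using fun x : s => hmem x.1 x.2
  -- the real eigenvalues
  choose L hL using fun x : s => (hUT x).real
  have hbx : ∀ x : s, ((b x : cuspSubmodule hΓ hneg hd hF σ) : Lp ℂ 2 μF) =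
      ((x.1 : cuspSubmodule hΓ hneg hd hF σ) : Lp ℂ 2 μF) := fun x => by
    rw [show b x = x.1 from congrFun hb x]
  have hub : ∀ x : s, U x =ᵐ[μF] ((b x : cuspSubmodule hΓ hneg hd hF σ) : Lp ℂ 2 μF) := fun x => by
    rw [hbx]; exact hUx x
  have hL2 : ∀ x : s, MemLp (U x) 2 μF := fun x => (Lp.memLp _).ae_eq (hub x).symm
  -- orthonormality on `F`
  have horth : ∀ x y : s, ∫ z in F, U x z * conj (U y z) = if x = y then 1 else 0 := by
    intro x y
    have h := orthonormal_iff_ite.mp b.orthonormal y x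
    rw [Submodule.coe_inner, L2.inner_def] at h
    have e : (fun z => ⟪((b y : cuspSubmodule hΓ hneg hd hF σ) : Lp ℂ 2 μF) z,
        ((b x : cuspSubmodule hΓ hneg hd hF σ) : Lp ℂ 2 μF) z⟫_ℂ) =ᵐ[μF] fun z => U x z * conj (U y z) := by
      filter_upwards [hub x, hub y] with z hx hy
      rw [← hx, ← hy]
      simp
    rw [integral_congr_ae e] at h
    rw [h]
    by_cases hxy : x = y
    · subst hxy; simp
    · rw [if_neg hxy, if_neg (Ne.symm hxy)]
  -- finiteness of the small cusp forms
  have hfin : {x : s | L x < 1 / 4}.Finite := by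
    set κ₀ : LipKernel := stLipKernel
    have hk₀ : IsTestKernel (stKernel 1 0) := isTestKernel_stKernel one_pos le_rfl
    set m : ℝ := (selbergTransform (stKernel 1 0) (Complex.I * (0 : ℝ))).re with hm
    have hm0 : 0 < m := selbergTransform_zero_re_pos hk₀ (stKernel_nonneg 1 0) integral_stKernel_one_zero_pos
    have hT : IsCompactOperator (cuspFamily (σ := σ) hΓ hneg hd hF κ₀) :=
      isCompactOperator_cuspFamily hΓ hneg hd hF hvol hinfty hper hineq hcomplete κ₀
    -- the small basis vectors as an orthonormal family of eigenvectors
    set Sm := {x : s | L x < 1 / 4}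
    have he : Orthonormal ℂ (fun x : Sm => b x.1) := b.orthonormal.comp _ Subtype.val_injective
    have heig : ∀ x : Sm, cuspFamily (σ := σ) hΓ hneg hd hF κ₀ (b x.1) = selbergTransform (stKernel 1 0) (T x.1) • b x.1 := by
      intro x
      have h1 := hUeig x.1 κ₀
      rw [show b x.1 = x.1.1 from congrFun hb x.1]
      exact h1
    have hμ : ∀ x : Sm, m ≤ ‖selbergTransform (stKernel 1 0) (T x.1)‖ := fun x =>
      (re_zero_lt_norm_selbergTransform_of_small hk₀ (stKernel_nonneg 1 0) integral_stKernel_one_zero_pos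
        (l := L x.1) x.2 (hL x.1)).le
    have hfinite : Finite Sm := finite_of_isCompactOperator_of_orthonormal_eigenvectors hT he heig hm0 hμ
    exact Set.toFinite Sm
  refine ⟨⟨s, inferInstance, L, U, fun x => (hUT x).automorphic, fun x => (hUT x).isC2, fun x z => ?_,
    fun x i z => (hUT x).cuspidal i z,
    fun x hx => by
      have e : hx.toLp (U x) = ((b x : cuspSubmodule hΓ hneg hd hF σ) : Lp ℂ 2 μF) :=
        Lp.ext ((MemLp.coeFn_toLp hx).trans (hub x))
      rw [e]; exact Submodule.coe_mem _,
    fun x => (memLp_two_iff_integrable_sq_norm (hL2 x).1).mp (hL2 x),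
    fun x => by have := horth x x; simpa using this,
    fun x y hxy => by rw [horth x y, if_neg hxy], hfin, fun f hf => ?_⟩⟩
  · -- the eigen-equation with the real eigenvalue
    rw [← hL x]
    exact (hUT x).eigen z
  · -- Parseval on `𝓒`
    set P := (cuspSubmodule hΓ hneg hd hF σ).orthogonalProjectionOnto with hP
    set v := hf.toLp f with hv
    have hsum := b.hasSum_inner_mul_inner (P v) (P v)
    have hterm : ∀ x : s, ⟪P v, b x⟫_ℂ * ⟪b x, P v⟫_ℂ = ((‖∫ z in F, conj (U x z) * f z‖ ^ 2 : ℝ) : ℂ) := by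
      intro x
      rw [Submodule.inner_orthogonalProjectionOnto_eq_of_mem_right, Submodule.inner_orthogonalProjectionOnto_eq_of_mem_left,
        ← inner_conj_symm, inner_coe_toLp_eq _ hf (hub x)]
      rw [Complex.conj_mul', ← Complex.ofReal_pow]   -- conj a * a = ‖a‖^2
    have hnorm : ⟪P v, P v⟫_ℂ = ((‖P v‖ ^ 2 : ℝ) : ℂ) := by
      rw [inner_self_eq_norm_sq_to_K]; norm_cast
    simp_rw [hterm, hnorm] at hsum
    exact Complex.hasSum_ofReal.mp hsum

include hvol hinfty hper hineq hcomplete in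
/-- **The cuspidal resolution** of a finite volume group with a complete cusp system (a choice).
[cite: Iwaniec2002, Thm 4.7, PDF p. 52] -/
def cuspidalResolution : CuspidalResolution hΓ hneg hd hF σ :=
  (nonempty_cuspidalResolution hΓ hneg hd hF hvol hinfty hper hineq hcomplete).some

namespace CuspidalResolution

variable {hΓ hneg hd hF} (C : CuspidalResolution hΓ hneg hd hF σ)

/-- The cusp forms are continuous. [folklore] -/
theorem continuous_u (x : C.ι) : Continuous (C.u x) := (C.isC2_u x).continuous

/-- The cusp forms are in `L²(F)`. [folklore] -/
theorem memLp_u (x : C.ι) : MemLp (C.u x) 2 ((volume : Measure ℍ).restrict F) :=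
  (memLp_two_iff_integrable_sq_norm (C.continuous_u x).aestronglyMeasurable.restrict).mpr (C.sqIntegrable_u x)

end CuspidalResolution

/-! ## 4. Assembly: the spectral resolution from its cuspidal, residual and Eisenstein parts -/

/-- The Eisenstein subspace attached to a (cuspidal) subspace `𝓒` and a set `R` of residual
classes: `𝓔₀ = (𝓒 ⊔ span R)ᗮ` (for `SL₂(ℤ)`: `eisSubspace = ((ℂ ∙ 1) ⊔ 𝓒)ᗮ` of
`EisensteinSpectralProjection`). [cite: Iwaniec2002, §7.1 & Thm 7.3, PDF pp. 69, 75] -/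
def eisSubspaceOf {V : Type*} [NormedAddCommGroup V] [InnerProductSpace ℂ V] (𝓒 : Submodule ℂ V) (R : Set V) :
    Submodule ℂ V := (𝓒 ⊔ Submodule.span ℂ R)ᗮ

/-- `𝓔₀` is complete. [folklore] -/
instance {V : Type*} [NormedAddCommGroup V] [InnerProductSpace ℂ V] [CompleteSpace V] (𝓒 : Submodule ℂ V) (R : Set V) :
    CompleteSpace (eisSubspaceOf 𝓒 R) := (Submodule.isClosed_orthogonal _).completeSpace_coe

/-- A vector orthogonal to every element of `R` is orthogonal to `span R`. [folklore] -/
theorem mem_orthogonal_span_of_forall_inner {V : Type*} [NormedAddCommGroup V] [InnerProductSpace ℂ V]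
    {R : Set V} {v : V} (h : ∀ r ∈ R, ⟪r, v⟫_ℂ = 0) : v ∈ (Submodule.span ℂ R)ᗮ := by
  rw [Submodule.mem_orthogonal]
  intro u hu
  induction hu using Submodule.span_induction with
  | mem x hx => exact h x hx
  | zero => exact inner_zero_left _
  | add x y _ _ hx hy => rw [inner_add_left, hx, hy, add_zero]
  | smul a x _ hx => rw [inner_smul_left, hx, mul_zero]

/-- **The residual and Eisenstein parts of the spectral resolution** (data; the hypothesis schema for
the output of Chapters 6–7 for a general group, complementing `CuspidalResolution`): a finite
orthonormal family of classes `ρ_l ∈ L²(F)` (in the book: the residues `u_{𝔞j}` of the Eisenstein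
series at the poles `1/2 < s_j ≤ 1`, Theorem 6.10 / (7.11), orthonormalised) represented by
automorphic `C²` eigenfunctions `(Δ + λ_l)ρ_l = 0` and orthogonal to the cusp forms, the
eigenpackets `E_𝔞(z, r)` (`E_𝔞(z, 1/2 + ir)` continued, automorphic `C²`, `(Δ + 1/4 + r²)E = 0`,
continuous in `r`), the square-integrability of the Eisenstein coefficients of test functions, and
**(7.15) on the Eisenstein subspace `𝓔₀ = (𝓒 ⊔ span{ρ_l})ᗮ` paired with `f`**:
`(1/4π) Σ_𝔞 ∫ |∫_F Ē_𝔞(·, r) f dμ|² dr = ‖P_{𝓔₀}[f]‖²` for every test function `f`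
(Theorem 7.3: "`Δ` has purely continuous spectrum on `𝓔(Γ\ℍ)` …", with Prop. 7.1).
[cite: Iwaniec2002, Thm 7.3 (7.11)–(7.15) & Prop. 7.1, PDF pp. 69–75; Thm 6.10, PDF p. 88] -/
structure SpectralParts (hΓ : Γ ≤ (Matrix.SpecialLinearGroup.toGL : SL(2, ℝ) →* GL (Fin 2) ℝ).range)
    (hneg : (-1 : GL (Fin 2) ℝ) ∈ Γ) (hd : IsDiscreteSubgroup Γ) (hF : IsHypFundamentalDomain Γ F)
    (σ : Fin h → SL(2, ℝ)) where
  /-- the number of residual forms (residues of Eisenstein series in `1/2 < s ≤ 1`, with multiplicity) -/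
  m : ℕ
  /-- their eigenvalues `λ_l = s_l(1 - s_l)` -/
  lamR : Fin m → ℝ
  /-- the residual forms -/
  ρ : Fin m → ℍ → ℂ
  /-- their classes in `L²(F)` -/
  ρLp : Fin m → Lp ℂ 2 ((volume : Measure ℍ).restrict F)
  automorphic_ρ : ∀ l, IsAutomorphic Γ (ρ l)
  isC2_ρ : ∀ l, IsC2 (ρ l)
  eigen_ρ : ∀ l z, hypLaplacian (ρ l) z + (lamR l : ℂ) * ρ l z = 0
  ρ_ae_eq : ∀ l, ρ l =ᵐ[(volume : Measure ℍ).restrict F] ρLp l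
  orthonormal_ρ : Orthonormal ℂ ρLp
  orthogonal_cusp : ∀ l, ρLp l ∈ (cuspSubmodule hΓ hneg hd hF σ)ᗮ
  /-- the number of eigenpackets (inequivalent cusps) -/
  c : ℕ
  /-- the Eisenstein series on the critical line -/
  E : Fin c → ℍ → ℝ → ℂ
  automorphic_E : ∀ a r, IsAutomorphic Γ (fun z => E a z r)
  isC2_E : ∀ a r, IsC2 (fun z => E a z r)
  eigen_E : ∀ a r z, hypLaplacian (fun z => E a z r) z + ((1 / 4 + r ^ 2 : ℝ) : ℂ) * E a z r = 0
  continuous_E : ∀ a z, Continuous (E a z)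
  memLp_eisCoeff : ∀ f : ℍ → ℂ, IsFdTestOn Γ F f →
    ∀ a, MemLp (fun r : ℝ => ∫ z in F, conj (E a z r) * f z) 2 (volume : Measure ℝ)
  /-- (7.15) on `𝓔₀` paired with a test function -/
  eisenstein : ∀ f : ℍ → ℂ, IsFdTestOn Γ F f → ∀ hf2 : MemLp f 2 ((volume : Measure ℍ).restrict F),
    1 / (4 * π) * ∑ a, ∫ r : ℝ, ‖∫ z in F, conj (E a z r) * f z‖ ^ 2 =
      ‖(eisSubspaceOf (cuspSubmodule hΓ hneg hd hF σ) (Set.range ρLp)).orthogonalProjectionOnto (hf2.toLp f)‖ ^ 2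

namespace SpectralParts

variable {hΓ hneg hd hF}

/-- **Pythagoras in `L²(F) = 𝓒 ⊕ span{ρ_l} ⊕ 𝓔₀`**: for `v ∈ L²(F)`,
`‖v‖² = ‖P_𝓒 v‖² + Σ_l |⟨ρ_l, v⟩|² + ‖P_{𝓔₀} v‖²` (`ρ_l` orthonormal in `𝓒ᗮ`). [folklore] -/
theorem norm_sq_eq_three_parts (P : SpectralParts hΓ hneg hd hF σ) (v : Lp ℂ 2 ((volume : Measure ℍ).restrict F)) :
    ‖v‖ ^ 2 = ‖(cuspSubmodule hΓ hneg hd hF σ).orthogonalProjectionOnto v‖ ^ 2 +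
      (∑ l, ‖⟪P.ρLp l, v⟫_ℂ‖ ^ 2) +
      ‖(eisSubspaceOf (cuspSubmodule hΓ hneg hd hF σ) (Set.range P.ρLp)).orthogonalProjectionOnto v‖ ^ 2 := by
  set 𝓒 := cuspSubmodule hΓ hneg hd hF σ with h𝓒
  set Rset : Set (Lp ℂ 2 ((volume : Measure ℍ).restrict F)) := Set.range P.ρLp with hRset
  set 𝓔 := eisSubspaceOf 𝓒 Rset with h𝓔
  have hortho := P.orthonormal_ρ
  -- the residual component
  set vR : Lp ℂ 2 ((volume : Measure ℍ).restrict F) := ∑ l, ⟪P.ρLp l, v⟫_ℂ • P.ρLp l with hvR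
  set v₁ := v - vR with hv₁
  have hvR_mem : vR ∈ Submodule.span ℂ Rset :=
    Submodule.sum_mem _ fun l _ => Submodule.smul_mem _ _ (Submodule.subset_span ⟨l, rfl⟩)
  have hv₁R : ∀ l, ⟪P.ρLp l, v₁⟫_ℂ = 0 := by
    intro l
    simp only [hv₁, hvR, inner_sub_right]
    rw [hortho.inner_right_fintype]
    ring
  have hvR_v₁ : ⟪vR, v₁⟫_ℂ = 0 := by
    simp only [hvR, sum_inner, inner_smul_left]
    exact Finset.sum_eq_zero fun l _ => by rw [hv₁R l, mul_zero]
  have hnorm1 : ‖v‖ ^ 2 = ‖vR‖ ^ 2 + ‖v₁‖ ^ 2 := by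
    have e : v = vR + v₁ := by simp only [hv₁]; abel
    have h := @norm_add_sq_eq_norm_sq_add_norm_sq_of_inner_eq_zero ℂ _ _ _ _ vR v₁ hvR_v₁
    rw [← e] at h
    simpa [sq] using h
  have hnormR : ‖vR‖ ^ 2 = ∑ l, ‖⟪P.ρLp l, v⟫_ℂ‖ ^ 2 := by
    have h := hortho.inner_sum (fun l => ⟪P.ρLp l, v⟫_ℂ) (fun l => ⟪P.ρLp l, v⟫_ℂ) Finset.univ
    rw [← hvR] at h
    have h2 : (‖vR‖ ^ 2 : ℝ) = RCLike.re ⟪vR, vR⟫_ℂ := (inner_self_eq_norm_sq (𝕜 := ℂ) vR).symm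
    rw [h2, h, map_sum]
    refine Finset.sum_congr rfl fun l _ => ?_
    rw [Complex.conj_mul', RCLike.re_to_complex, ← Complex.ofReal_pow, Complex.ofReal_re]
  -- the cuspidal and Eisenstein components of `v₁`
  have hvR_orth : vR ∈ 𝓒ᗮ := Submodule.sum_mem _ fun l _ => Submodule.smul_mem _ _ (P.orthogonal_cusp l)
  have hP𝓒 : 𝓒.orthogonalProjectionOnto v₁ = 𝓒.orthogonalProjectionOnto v := by
    simp only [hv₁, map_sub, (Submodule.orthogonalProjectionOnto_eq_zero_iff (K := 𝓒)).mpr hvR_orth, sub_zero]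
  have hnorm2 := Submodule.norm_sq_eq_add_norm_sq_projection v₁ 𝓒
  set v₂ : Lp ℂ 2 ((volume : Measure ℍ).restrict F) := 𝓒ᗮ.starProjection v₁ with hv₂
  have hv₂_eq : v₂ = v₁ - 𝓒.starProjection v₁ := by
    rw [hv₂, eq_sub_iff_add_eq, add_comm, Submodule.starProjection_add_starProjection_orthogonal]
  -- `v₂` is the projection of `v` onto `𝓔₀`
  have hv₂𝓒 : v₂ ∈ 𝓒ᗮ := by rw [hv₂, Submodule.starProjection_apply]; exact Submodule.coe_mem _
  have hv₂R : v₂ ∈ (Submodule.span ℂ Rset)ᗮ := by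
    refine mem_orthogonal_span_of_forall_inner fun r hr => ?_
    obtain ⟨l, rfl⟩ := hr
    rw [hv₂_eq, inner_sub_right, hv₁R l, zero_sub, neg_eq_zero]
    have hmem : 𝓒.starProjection v₁ ∈ 𝓒 := Submodule.starProjection_apply_mem _ _
    exact Submodule.inner_left_of_mem_orthogonal hmem (P.orthogonal_cusp l)
  have hv₂𝓔 : v₂ ∈ 𝓔 := by
    show v₂ ∈ (𝓒 ⊔ Submodule.span ℂ Rset)ᗮ
    rw [← Submodule.inf_orthogonal]
    exact ⟨hv₂𝓒, hv₂R⟩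
  have hdiff : v - v₂ ∈ 𝓔ᗮ := by
    have hmem : v - v₂ ∈ 𝓒 ⊔ Submodule.span ℂ Rset := by
      have e : v - v₂ = 𝓒.starProjection v₁ + vR := by rw [hv₂_eq, hv₁]; abel
      rw [e]
      exact Submodule.add_mem _ (Submodule.mem_sup_left (Submodule.starProjection_apply_mem _ _))
        (Submodule.mem_sup_right hvR_mem)
    exact Submodule.le_orthogonal_orthogonal _ hmem
  have hP𝓔 : 𝓔.starProjection v = v₂ :=
    Submodule.eq_starProjection_of_mem_orthogonal' hv₂𝓔 hdiff (by abel)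
  have hnormE : ‖𝓔.orthogonalProjectionOnto v‖ = ‖v₂‖ := by
    rw [← hP𝓔, Submodule.starProjection_apply, Submodule.norm_coe]
  have hnorm2' : ‖v₁‖ ^ 2 = ‖𝓒.orthogonalProjectionOnto v‖ ^ 2 + ‖v₂‖ ^ 2 := by
    rw [hnorm2, hP𝓒, hv₂, Submodule.starProjection_apply, Submodule.norm_coe]
  rw [hnorm1, hnormR, hnorm2', hnormE]
  ring

variable (hvol : volume F < ⊤)
  (hinfty : ∀ i, (Matrix.SpecialLinearGroup.toGL (σ i) : GL (Fin 2) ℝ) • (OnePoint.infty : OnePoint ℝ) = 𝔞 i)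
  (hper : ∀ i, (ConjAct.toConjAct (Matrix.SpecialLinearGroup.toGL (σ i) : GL (Fin 2) ℝ)⁻¹ • Γ).strictPeriods =
    AddSubgroup.zmultiples 1)
  (hineq : ∀ i j, ∀ γ ∈ Γ, γ • 𝔞 i = 𝔞 j → i = j)
  (hcomplete : ∀ c : OnePoint ℝ, IsCusp c Γ → ∃ i, ∃ γ ∈ Γ, γ • 𝔞 i = c)

/-- **The spectral resolution of `L²(Γ\ℍ)` from its parts**: the cuspidal resolution (Theorem 4.7,
`cuspidalResolution`, in the tree) together with residual and Eisenstein parts `P` satisfying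
(7.15) on `𝓔₀` yields `SpectralResolution Γ F` — the discrete family is `{u_x} ∪ {ρ_l}`, and
Parseval for a test function `f` is Pythagoras in `L²(F) = 𝓒 ⊕ span{ρ_l} ⊕ 𝓔₀` with (4.15) on `𝓒`
and (7.15) on `𝓔₀`. Hence (`Iwaniec2002_eq_12_5_of_spectralResolution`) (12.5) and Theorem 12.1 for
`Γ` follow from `SpectralParts` alone. [cite: Iwaniec2002, Thm 4.7 & Thm 7.3, PDF pp. 52, 75 ("Combining Theorems 4.7 and 7.3 …")] -/
def toResolution (P : SpectralParts hΓ hneg hd hF σ) : SpectralResolution Γ F :=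
  let C := cuspidalResolution hΓ hneg hd hF hvol hinfty hper hineq hcomplete
  { ι := C.ι ⊕ Fin P.m
    countable_ι := by haveI := C.countable_ι; infer_instance
    lam := Sum.elim C.lam P.lamR
    u := Sum.elim C.u P.ρ
    c := P.c
    E := P.E
    automorphic_u := by rintro (x | l); exacts [C.automorphic_u x, P.automorphic_ρ l]
    isC2_u := by rintro (x | l); exacts [C.isC2_u x, P.isC2_ρ l]
    eigen_u := by rintro (x | l) z; exacts [C.eigen_u x z, P.eigen_ρ l z]
    sqIntegrable_u := by
      rintro (x | l)
      · exact C.sqIntegrable_u x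
      · have h : MemLp (P.ρ l) 2 ((volume : Measure ℍ).restrict F) := (Lp.memLp _).ae_eq (P.ρ_ae_eq l).symm
        exact (memLp_two_iff_integrable_sq_norm h.1).mp h
    norm_u := by
      rintro (x | l)
      · exact C.norm_u x
      · show ∫ z in F, P.ρ l z * conj (P.ρ l z) = 1
        have h1 : ⟪P.ρLp l, P.ρLp l⟫_ℂ = 1 := by
          rw [inner_self_eq_norm_sq_to_K, P.orthonormal_ρ.1 l]; simp
        rw [L2.inner_def] at h1
        rw [← h1]
        refine integral_congr_ae ?_
        filter_upwards [P.ρ_ae_eq l] with z hz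
        rw [← hz, Complex.mul_conj', inner_self_eq_norm_sq_to_K]
        norm_cast
    orthogonal_u := by
      rintro (x | l) (y | l') hne
      · exact C.orthogonal_u x y fun h => hne (by rw [h])
      · -- cusp form against residual form: `⟪ρ_{l'}, [u_x]⟫ = ∫ conj(ρ_{l'}) u_x = 0`
        show ∫ z in F, C.u x z * conj (P.ρ l' z) = 0
        have h := Submodule.inner_left_of_mem_orthogonal (C.toLp_mem_cusp x (C.memLp_u x)) (P.orthogonal_cusp l')
        rw [inner_coe_toLp_eq (P.ρLp l') (C.memLp_u x) (P.ρ_ae_eq l')] at h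
        rw [← h]
        exact integral_congr_ae (Eventually.of_forall fun z => by ring)
      · -- residual form against cusp form
        show ∫ z in F, P.ρ l z * conj (C.u y z) = 0
        have h := Submodule.inner_left_of_mem_orthogonal (C.toLp_mem_cusp y (C.memLp_u y)) (P.orthogonal_cusp l)
        rw [inner_coe_toLp_eq (P.ρLp l) (C.memLp_u y) (P.ρ_ae_eq l)] at h
        have h' := congrArg conj h
        rw [map_zero, ← integral_conj] at h'
        rw [← h']
        refine integral_congr_ae (Eventually.of_forall fun z => ?_)
        simp
      · show ∫ z in F, P.ρ l z * conj (P.ρ l' z) = 0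
        have hll : l ≠ l' := fun h => hne (by rw [h])
        have h : ⟪P.ρLp l', P.ρLp l⟫_ℂ = 0 := P.orthonormal_ρ.2 hll.symm
        rw [L2.inner_def] at h
        rw [← h]
        refine integral_congr_ae ?_
        filter_upwards [P.ρ_ae_eq l, P.ρ_ae_eq l'] with z hz hz'
        rw [← hz, ← hz']; simp
    finite_small := by
      have h1 : (Sum.inl '' {x : C.ι | C.lam x < 1 / 4} ∪ Set.range Sum.inr : Set (C.ι ⊕ Fin P.m)).Finite :=
        (C.finite_small.image _).union (Set.finite_range _)
      refine h1.subset ?_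
      rintro (x | l) hx
      · exact Or.inl ⟨x, hx, rfl⟩
      · exact Or.inr ⟨l, rfl⟩
    automorphic_E := P.automorphic_E
    isC2_E := P.isC2_E
    eigen_E := P.eigen_E
    continuous_E := P.continuous_E
    memLp_eisCoeff := P.memLp_eisCoeff
    parseval := fun f hf => by
      have hf2 : MemLp f 2 ((volume : Measure ℍ).restrict F) := hf.memLp_two hF.measurableSet hvol
      have hthree := P.norm_sq_eq_three_parts (hf2.toLp f)
      have heis := P.eisenstein f hf hf2
      have hres : ∀ l, ⟪P.ρLp l, hf2.toLp f⟫_ℂ = ∫ z in F, conj (P.ρ l z) * f z := fun l =>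
        inner_coe_toLp_eq (P.ρLp l) hf2 (P.ρ_ae_eq l)
      -- the sum over `ι = C.ι ⊕ Fin m`
      have hsum1 : HasSum ((fun j : C.ι ⊕ Fin P.m => ‖∫ z in F, conj (Sum.elim C.u P.ρ j z) * f z‖ ^ 2) ∘ Sum.inl)
          (‖(cuspSubmodule hΓ hneg hd hF σ).orthogonalProjectionOnto (hf2.toLp f)‖ ^ 2) := C.parseval_cusp f hf2
      have hsum2 : HasSum ((fun j : C.ι ⊕ Fin P.m => ‖∫ z in F, conj (Sum.elim C.u P.ρ j z) * f z‖ ^ 2) ∘ Sum.inr)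
          (∑ l, ‖⟪P.ρLp l, hf2.toLp f⟫_ℂ‖ ^ 2) := by
        have h := hasSum_fintype fun l : Fin P.m => ‖∫ z in F, conj (P.ρ l z) * f z‖ ^ 2
        simp_rw [hres]
        exact h
      rw [(hsum1.sum hsum2).tsum_eq, ← norm_toLp_sq_eq_integral hf2, hthree, heis, add_assoc] }

end SpectralParts

/-- **(12.5) and Theorem 12.1 for a finite volume group from the residual and Eisenstein parts of its
spectral resolution** (the cusp forms being in the tree): pointwise form of
`Iwaniec2002_eq_12_5_of_spectralResolution` for one group. [cite: Iwaniec2002, (12.5), PDF pp. 125–126] -/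
theorem nonempty_spectralResolution_of_parts
    (hvol : volume F < ⊤)
    (hinfty : ∀ i, (Matrix.SpecialLinearGroup.toGL (σ i) : GL (Fin 2) ℝ) • (OnePoint.infty : OnePoint ℝ) = 𝔞 i)
    (hper : ∀ i, (ConjAct.toConjAct (Matrix.SpecialLinearGroup.toGL (σ i) : GL (Fin 2) ℝ)⁻¹ • Γ).strictPeriods =
      AddSubgroup.zmultiples 1)
    (hineq : ∀ i j, ∀ γ ∈ Γ, γ • 𝔞 i = 𝔞 j → i = j)
    (hcomplete : ∀ c : OnePoint ℝ, IsCusp c Γ → ∃ i, ∃ γ ∈ Γ, γ • 𝔞 i = c)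
    (P : SpectralParts hΓ hneg hd hF σ) : Nonempty (SpectralResolution Γ F) :=
  ⟨P.toResolution hvol hinfty hper hineq hcomplete⟩

end Fuchsian

end Literature.NumberTheory.Automorphic
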